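import Mathlib
import Summits.Ventures.PercRepro.TriangleCapThreeBelowPendant
import Summits.Ventures.PercRepro.TriangleCapDenseEquality
import Summits.Ventures.PercRepro.TriangleCapTwoBelowDiagonalTen
import Summits.Ventures.PercRepro.TriangleCapNineSixteenA

/-!
# PercRepro — FOUR BELOW THE DIAGONAL BY DELETING A PENDANT OR ISOLATED VERTEX (p3, gen 39; part 116)

The `r = 4` stability in the dense corner (`2m ≥ 6k − 26`, no product `a′(k − a′)` among `m, …, m + 3`) for a graph
with a vertex `z` of degree `≤ 1`, by deletion (`del`, gen 38) to the lower sub-diagonals at `k − 1`: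

* isolated `z`: `Σ_D d² = Σ_{D−z} d²` with `m` edges on `k − 1` vertices; `m ≥ 4k − 20` closes on the envelope
  (`Σ_{D−z} d² ≤ m (k − 1)`), otherwise the `r = 1` stability at `k − 1` (`dense_stability_eight`) pays `k − 3`
  (`m + k − 3 ≥ 4k − 20`), and a complete bipartite `D − z = K_{p, q}` is impossible: a side `≤ 3` makes
  `m + p = p (k − p)` a product among `m, …, m + 3`, two sides `≥ 4` make `m = pq ≥ 4 (k − 5)`;
* pendant `z` at `x`: `Σ_D d² = Σ_{D−z} d² + 2 d′(x) + 2` with `d′(x) ≤ k − 3` (a dominating `x` gives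
  `2m ≤ 3 (k − 1)`), `m − 1` edges on `k − 1` vertices; the `r = 2` stability at `k − 1` (`dense_stability_two_of_ten`
  for `k ≥ 11`, `dense_stability_two_nine_sixteen` at `k = 10`, where the product-free hypothesis forces `m = 17`)
  pays `2 (k − 4)` and `m − 3k + 17 ≥ 0` closes; when `D − z` is bipartite spanning with `N′ ≤ 1` missing pairs the
  star bound at `k − 1` and the arithmetic `pendant_bip_arith` close (`(p − 5)(q − 3) + N′(p + q − 2 − N′) ≥ 0`, the
  small sides excluded by the product-free hypothesis or the density).

The edge bound `4m ≤ k²` (`four_mul_card_edges_le_sq`) is Cauchy–Schwarz on the envelope.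
**`stability_four_of_pendant`**, **`stability_four_of_isolated`** ⇒ `Σ_v d(v)² + 4 (k − 5) ≤ m k`.  Axioms: standard.
-/

namespace PercRepro

namespace TriangleCap

namespace C047

open Finset

variable {V : Type*} [Fintype V] [DecidableEq V]

/-- Cauchy–Schwarz on the envelope: a `K₄⁻`-free graph on `k ≥ 6` vertices has `4m ≤ k²`. -/
theorem four_mul_card_edges_le_sq (D : SimpleGraph V) [DecidableRel D.Adj] (hK : K4mFree D)
    (hk : 6 ≤ Fintype.card V) : 4 * D.edgeFinset.card ≤ Fintype.card V * Fintype.card V := by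
  have hcs := sq_sum_le_card_mul_sum_sq (s := (univ : Finset V)) (f := deg D)
  rw [card_univ, Nat.cast_id, sum_deg_eq] at hcs
  have henv := sum_deg_sq_le_of_k4mFree D hK hk
  have hsq : ∑ v, deg D v ^ 2 = ∑ v, deg D v * deg D v := by
    apply sum_congr rfl
    intro v _
    ring
  rw [hsq] at hcs
  obtain ⟨m, hm⟩ : ∃ m, D.edgeFinset.card = m := ⟨_, rfl⟩
  obtain ⟨k, hk'⟩ : ∃ k, Fintype.card V = k := ⟨_, rfl⟩
  rw [hm, hk'] at hcs henv ⊢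
  rcases Nat.eq_zero_or_pos m with h0 | hpos
  · subst h0; omega
  · have h1 : (2 * m) ^ 2 ≤ k * (m * k) := le_trans hcs (Nat.mul_le_mul_left k henv)
    have h2 : m * (4 * m) ≤ m * (k * k) := by nlinarith
    exact Nat.le_of_mul_le_mul_left h2 hpos

omit [Fintype V] [DecidableEq V] in
/-- At `k = 10` the product-free hypothesis (`m, …, m + 3` not of the form `a′ (10 − a′)`) with `17 ≤ m ≤ 25` forces
`m = 17`. -/
theorem ten_forces_seventeen (m : ℕ) (hm : 17 ≤ m) (hm2 : 4 * m ≤ 100)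
    (hprod : ∀ a', a' ≤ 10 → m ≠ a' * (10 - a') ∧ m + 1 ≠ a' * (10 - a') ∧ m + 2 ≠ a' * (10 - a') ∧
      m + 3 ≠ a' * (10 - a')) : m = 17 := by
  have h3 := hprod 3 (by norm_num)
  have h4 := hprod 4 (by norm_num)
  have h5 := hprod 5 (by norm_num)
  norm_num at h3 h4 h5
  omega

omit [Fintype V] [DecidableEq V] in
/-- The arithmetic of the pendant reduction when `D − z` is bipartite spanning with `N ≤ 1` missing pairs: parts
`p` (the side of `x`) and `q`, `m′ + N = pq` (`m′ = m − 1`), `d′(x) ≤ q`, the star bound `S + N (k′ − 1 − N) ≤ m′ k′`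
on `D − z` (`k′ = p + q`), the density and the product-free hypothesis ⇒ `S + 2 d′ + 2 + 4 (k − 5) ≤ m k`. -/
theorem pendant_bip_arith (p q N m' d S : ℕ) (hN : N ≤ 1) (hNm : N + m' = p * q) (hd : d ≤ q)
    (hk : 10 ≤ p + q + 1) (hm : 6 * (p + q + 1) ≤ 2 * (m' + 1) + 26)
    (hprod : ∀ a', a' ≤ p + q + 1 → m' + 1 ≠ a' * (p + q + 1 - a') ∧ m' + 1 + 1 ≠ a' * (p + q + 1 - a') ∧
      m' + 1 + 2 ≠ a' * (p + q + 1 - a') ∧ m' + 1 + 3 ≠ a' * (p + q + 1 - a'))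
    (hS : S + N * (p + q - N - 1) ≤ m' * (p + q)) :
    S + 2 * d + 1 + 1 * 1 + 4 * (p + q + 1 - 5) ≤ (m' + 1) * (p + q + 1) := by
  have hp := hprod p (by omega)
  have e : p + q + 1 - p = q + 1 := by omega
  rw [e] at hp
  have e3 : p + q + 1 - 5 = p + q - 4 := by omega
  rw [e3]
  obtain ⟨t, ht⟩ : ∃ t, p + q = t + 4 := ⟨p + q - 4, by omega⟩
  have e4 : p + q - 4 = t := by omega
  rw [e4]
  rcases Nat.le_one_iff_eq_zero_or_eq_one.mp hN with hN0 | hN1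
  · subst hN0
    simp only [zero_mul, add_zero, zero_add] at hS hNm
    -- `m′ = pq`: a side `p ≤ 4` makes `p (q + 1) = m + p − 1` a product among `m, …, m + 3`
    by_cases hp4 : p ≤ 4
    · exfalso
      interval_cases p <;> omega
    · by_cases hq2 : q ≤ 2
      · exfalso
        interval_cases q <;> nlinarith
      · obtain ⟨p', hp'⟩ : ∃ p', p = p' + 5 := ⟨p - 5, by omega⟩
        obtain ⟨q', hq'⟩ : ∃ q', q = q' + 3 := ⟨q - 3, by omega⟩
        subst hp' hq'
        nlinarith
  · subst hN1
    -- `m′ + 1 = pq`: a side `p ≤ 3` makes `p (q + 1) = m + p` a product among `m + 1, …, m + 3`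
    by_cases hp3 : p ≤ 3
    · exfalso
      interval_cases p <;> omega
    · by_cases hq1 : q ≤ 1
      · exfalso
        interval_cases q <;> nlinarith
      · obtain ⟨p', hp'⟩ : ∃ p', p = p' + 4 := ⟨p - 4, by omega⟩
        obtain ⟨q', hq'⟩ : ∃ q', q = q' + 2 := ⟨q - 2, by omega⟩
        subst hp' hq'
        have e5 : p' + 4 + (q' + 2) - 1 - 1 = p' + q' + 4 := by omega
        rw [e5] at hS
        nlinarith

/-- **THE ISOLATED-VERTEX REDUCTION AT `r = 4`:** `K₄⁻`-free, `k ≥ 10`, `2m ≥ 6k − 26`, no product `a′ (k − a′)` among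
`m, …, m + 3`, an isolated vertex ⇒ `Σ_v d(v)² + 4 (k − 5) ≤ m k`. -/
theorem stability_four_of_isolated (D : SimpleGraph V) [DecidableRel D.Adj] (hK : K4mFree D)
    (hk : 10 ≤ Fintype.card V) (hm : 6 * Fintype.card V ≤ 2 * D.edgeFinset.card + 26)
    (hprod : ∀ a', a' ≤ Fintype.card V → D.edgeFinset.card ≠ a' * (Fintype.card V - a') ∧
      D.edgeFinset.card + 1 ≠ a' * (Fintype.card V - a') ∧ D.edgeFinset.card + 2 ≠ a' * (Fintype.card V - a') ∧
      D.edgeFinset.card + 3 ≠ a' * (Fintype.card V - a'))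
    {z : V} (hz : deg D z = 0) :
    ∑ v, deg D v * deg D v + 4 * (Fintype.card V - 5) ≤ D.edgeFinset.card * Fintype.card V := by
  have hnb : ∀ w, ¬ D.Adj z w := by
    intro w hw
    unfold deg at hz
    rw [card_eq_zero, filter_eq_empty_iff] at hz
    exact hz (mem_univ w) hw
  have hcard := card_del z
  have hedges := card_edges_del D z
  rw [hz, add_zero] at hedges
  have hsq := sum_deg_sq_del D z
  rw [hz] at hsq
  have hsum1 : ∑ a : {v : V // v ≠ z}, (if D.Adj a.1 z then deg (del D z) a else 0) = 0 := by
    apply sum_eq_zero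
    intro a _
    have : ¬ D.Adj a.1 z := fun h => hnb a.1 (D.adj_symm h)
    simp only [this, if_false]
  rw [hsum1] at hsq
  obtain ⟨k', hk'⟩ : ∃ k', Fintype.card {v : V // v ≠ z} = k' := ⟨_, rfl⟩
  rw [hk'] at hcard
  have hkV : Fintype.card V = k' + 1 := by omega
  have hK' := k4mFree_del D hK z
  by_cases hbig : 4 * Fintype.card V ≤ D.edgeFinset.card + 20
  · -- `m ≥ 4k − 20`: the envelope on `D − z`
    have h1 := sum_deg_sq_le_of_k4mFree (del D z) hK' (by omega)
    rw [hk', hedges] at h1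
    rw [hkV, hsq]
    have e1 : k' + 1 - 5 = k' - 4 := by omega
    rw [e1]
    obtain ⟨k'', hk''⟩ : ∃ k'', k' = k'' + 4 := ⟨k' - 4, by omega⟩
    subst hk''
    have e3 : k'' + 4 - 4 = k'' := by omega
    rw [e3]
    rw [hkV] at hbig
    nlinarith
  by_cases hbip : ∃ A : Finset {v : V // v ≠ z}, ∀ a b, (del D z).Adj a b ↔ Xor (a ∈ A) (b ∈ A)
  · -- a complete bipartite `D − z = K_{p, q}` is excluded
    exfalso
    obtain ⟨A, hA⟩ := hbip
    have hmpq := card_edges_eq_of_complete_bipartite (del D z) A hA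
    rw [hk', hedges] at hmpq
    have hAk : A.card ≤ k' := by
      have := card_le_univ A
      rwa [hk'] at this
    obtain ⟨p, hp⟩ : ∃ p, A.card = p := ⟨_, rfl⟩
    rw [hp] at hmpq hAk
    obtain ⟨q, hq⟩ : ∃ q, k' = p + q := ⟨k' - p, by omega⟩
    subst hq
    have e1 : p + q - p = q := by omega
    rw [e1] at hmpq
    rw [hkV] at hprod hbig hm
    by_cases hp3 : p ≤ 3
    · have hpr := hprod p (by omega)
      have e2 : p + q + 1 - p = q + 1 := by omega
      rw [e2] at hpr
      interval_cases p <;> omega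
    · by_cases hq3 : q ≤ 3
      · have hpr := hprod q (by omega)
        have e2 : p + q + 1 - q = p + 1 := by omega
        rw [e2] at hpr
        interval_cases q <;> omega
      · nlinarith
  · -- the `r = 1` stability at `k − 1`
    have h1 := dense_stability_eight (del D z) hK' (by omega) (by omega) hbip
    rw [hk', hedges] at h1
    rw [hkV, hsq]
    have e1 : k' + 1 - 5 = k' - 4 := by omega
    rw [e1]
    obtain ⟨k'', hk''⟩ : ∃ k'', k' = k'' + 4 := ⟨k' - 4, by omega⟩
    subst hk''
    have e3 : k'' + 4 - 4 = k'' := by omega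
    have e4 : k'' + 4 - 2 = k'' + 2 := by omega
    rw [e3]
    rw [e4] at h1
    rw [hkV] at hm
    nlinarith

/-- **THE PENDANT REDUCTION AT `r = 4`:** `K₄⁻`-free, `k ≥ 10`, `2m ≥ 6k − 26`, no product `a′ (k − a′)` among
`m, …, m + 3`, a vertex of degree `1` ⇒ `Σ_v d(v)² + 4 (k − 5) ≤ m k`. -/
theorem stability_four_of_pendant (D : SimpleGraph V) [DecidableRel D.Adj] (hK : K4mFree D)
    (hk : 10 ≤ Fintype.card V) (hm : 6 * Fintype.card V ≤ 2 * D.edgeFinset.card + 26)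
    (hprod : ∀ a', a' ≤ Fintype.card V → D.edgeFinset.card ≠ a' * (Fintype.card V - a') ∧
      D.edgeFinset.card + 1 ≠ a' * (Fintype.card V - a') ∧ D.edgeFinset.card + 2 ≠ a' * (Fintype.card V - a') ∧
      D.edgeFinset.card + 3 ≠ a' * (Fintype.card V - a'))
    {z : V} (hz : deg D z = 1) :
    ∑ v, deg D v * deg D v + 4 * (Fintype.card V - 5) ≤ D.edgeFinset.card * Fintype.card V := by
  have hz' := hz
  unfold deg at hz'
  obtain ⟨x, hx⟩ := card_eq_one.mp hz'
  have hzx : D.Adj z x := by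
    have : x ∈ univ.filter (fun w => D.Adj z w) := by rw [hx]; exact mem_singleton_self x
    exact (mem_filter.mp this).2
  have hnb : ∀ w, D.Adj z w → w = x := by
    intro w hw
    have : w ∈ univ.filter (fun w => D.Adj z w) := mem_filter.mpr ⟨mem_univ w, hw⟩
    rw [hx, mem_singleton] at this
    exact this
  have hxz : x ≠ z := hzx.ne.symm
  have hcard := card_del z
  have hedges := card_edges_del D z
  rw [hz] at hedges
  have hsq := sum_deg_sq_del D z
  rw [hz] at hsq
  have hsum1 : ∑ a : {v : V // v ≠ z}, (if D.Adj a.1 z then deg (del D z) a else 0) =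
      deg (del D z) ⟨x, hxz⟩ := by
    rw [sum_eq_single ⟨x, hxz⟩]
    · simp only [D.adj_symm hzx, if_true]
    · intro a _ ha
      have : ¬ D.Adj a.1 z := fun h => ha (Subtype.ext (hnb a.1 (D.adj_symm h)))
      simp only [this, if_false]
    · intro h; exact absurd (mem_univ _) h
  rw [hsum1] at hsq
  have hdx := deg_del D z ⟨x, hxz⟩
  simp only [D.adj_symm hzx, if_true] at hdx
  -- `x` is not dominating
  have hxdom : deg D x + 2 ≤ Fintype.card V := by
    by_contra h
    push Not at h
    have hle : deg D x ≤ Fintype.card V - 1 := by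
      unfold deg
      have hsub : univ.filter (fun w => D.Adj x w) ⊆ univ.erase x := by
        intro w hw
        rw [mem_filter] at hw
        rw [mem_erase]
        exact ⟨hw.2.ne.symm, mem_univ w⟩
      have := card_le_card hsub
      rw [card_erase_of_mem (mem_univ x), card_univ] at this
      exact this
    have hxd : deg D x + 1 = Fintype.card V := by omega
    have := two_mul_card_edges_le_of_dominating D hK hxd
    omega
  have hK' := k4mFree_del D hK z
  obtain ⟨k', hk'⟩ : ∃ k', Fintype.card {v : V // v ≠ z} = k' := ⟨_, rfl⟩
  obtain ⟨m', hm'⟩ : ∃ m', (del D z).edgeFinset.card = m' := ⟨_, rfl⟩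
  obtain ⟨d', hd'⟩ : ∃ d', deg (del D z) ⟨x, hxz⟩ = d' := ⟨_, rfl⟩
  rw [hk'] at hcard
  rw [hm'] at hedges
  rw [hd'] at hsq hdx
  have hkV : Fintype.card V = k' + 1 := by omega
  have hmD : D.edgeFinset.card = m' + 1 := by omega
  by_cases hbip : ∃ A : Finset {v : V // v ≠ z}, (∀ a b, (del D z).Adj a b → (a ∈ A ↔ b ∉ A)) ∧
      (missing (del D z) A Aᶜ).card ≤ 1
  · -- `D − z` bipartite spanning with `≤ 1` missing pair: the star bound at `k − 1` and the arithmetic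
    obtain ⟨A, hA, hN⟩ := hbip
    have hstar := sum_deg_sq_le_of_bipartite (del D z) A hA
    have hNm := card_missing_add_card_edges (del D z) A hA
    have hAc : A.card + Aᶜ.card = k' := by rw [card_add_card_compl, hk']
    rw [hk', hm'] at hstar
    rw [hm'] at hNm
    obtain ⟨N, hNdef⟩ : ∃ N, (missing (del D z) A Aᶜ).card = N := ⟨_, rfl⟩
    rw [hNdef] at hstar hNm hN
    rw [hkV, hmD] at hprod hm ⊢
    rw [hkV] at hk
    rw [hsq]
    by_cases hxA : (⟨x, hxz⟩ : {v : V // v ≠ z}) ∈ A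
    · -- `x` on the side `A`: `d′(x) ≤ |Aᶜ|`
      have hdle : d' ≤ Aᶜ.card := by
        rw [← hd', deg_eq_card_filter_compl (del D z) A hA hxA]
        exact card_le_card (filter_subset _ _)
      obtain ⟨p, hp⟩ : ∃ p, A.card = p := ⟨_, rfl⟩
      obtain ⟨q, hq⟩ : ∃ q, Aᶜ.card = q := ⟨_, rfl⟩
      rw [hp, hq] at hAc hNm
      rw [hq] at hdle
      subst hAc
      exact pendant_bip_arith p q N m' d' _ hN hNm hdle hk hm hprod hstar
    · -- `x` off `A`: `d′(x) ≤ |A|`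
      have hdle : d' ≤ A.card := by
        rw [← hd', deg_eq_card_filter_left (del D z) A hA hxA]
        exact card_le_card (filter_subset _ _)
      obtain ⟨p, hp⟩ : ∃ p, Aᶜ.card = p := ⟨_, rfl⟩
      obtain ⟨q, hq⟩ : ∃ q, A.card = q := ⟨_, rfl⟩
      rw [hp, hq] at hAc hNm
      rw [hq] at hdle
      have hk2 : q + p = p + q := by ring
      rw [hk2] at hAc
      subst hAc
      have hNm' : N + m' = p * q := by rw [mul_comm]; exact hNm
      exact pendant_bip_arith p q N m' d' _ hN hNm' hdle hk hm hprod hstar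
  · -- the `r = 2` stability at `k − 1`
    have h1 : ∑ a : {v : V // v ≠ z}, deg (del D z) a * deg (del D z) a + 2 * (k' - 3) ≤ m' * k' := by
      by_cases hk10 : 10 ≤ k'
      · have := dense_stability_two_of_ten (del D z) hK' (by omega) (by omega) hbip
        rwa [hk', hm'] at this
      · have hk9 : k' = 9 := by omega
        have hm17 : m' + 1 = 17 := by
          have h4 := four_mul_card_edges_le_sq D hK (by omega)
          rw [hkV, hmD, hk9] at h4 hprod hm
          exact ten_forces_seventeen (m' + 1) (by omega) (by omega) hprod
        have := dense_stability_two_nine_sixteen (del D z) hK' (by omega) (by omega) hbip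
        rwa [hk', hm'] at this
    rw [hkV, hmD, hsq]
    have e1 : k' + 1 - 5 = k' - 4 := by omega
    rw [e1]
    have hd : d' + 2 ≤ k' := by omega
    obtain ⟨k'', hk''⟩ : ∃ k'', k' = k'' + 4 := ⟨k' - 4, by omega⟩
    subst hk''
    have e3 : k'' + 4 - 4 = k'' := by omega
    have e4 : k'' + 4 - 3 = k'' + 1 := by omega
    rw [e3]
    rw [e4] at h1
    rw [hkV, hmD] at hm
    nlinarith

end C047

end TriangleCap

end PercRepro
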